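import Mathlib.LinearAlgebra.PiTensorProduct.Basis
import Literature.LinearAlgebra.BaseChange.PiTensorIntegralForm
import Literature.AlgebraicGeometry.Motives.HodgeStructureExteriorPowerTensorPower
import HarnessLib

/-!
# Hodge structures of abelian type are closed under tensor powers (and exterior powers)

Family `hodge`, layer `Literature/AlgebraicGeometry/Motives`. THEOREMS plus the plumbing
definitions they need (linear equivalences / morphisms with bodies); no named fact is introduced
(net debt 0). Sequel of `Motives/HodgeStructureAbelianType` (the single-triple predicate
`HodgeStructure.IsOfAbelianType`: `H` is a direct summand, in `ℚ`-Hodge structures, of some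
`(H¹(A(ℂ); ℚ)^{⊗ m})(c)`), of `Motives/AbelianVarietyCohomologyAbelianType` (every `Hᵏ(A(ℂ); ℚ)` is
of abelian type) and of `Motives/HodgeStructureExteriorPowerTensorPower` (`⋀ᵏ H` is a retract of
`H^{⊗ k}` in `ℚ`-Hodge structures, every weight).

Sources read verbatim. Y. André, *Pour une théorie inconditionnelle des motifs*, Publ. Math. IHÉS
83 (1996) [Andre1996Motifs] (held text `paper:doi-10-1007-bf02698643`, PDF p. 27 = printed p. 30),
§6.1: "Ces motifs sont aussi les objets de la catégorie tannakienne `ℳ(𝒜b)_𝒱` engendrée par les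
`𝔥(A)` et les motifs d'Artin; elle contient les objets de Tate (`ℚ(-1)` est quotient de
`𝔥(A) ⊗ 𝔥(A)` si `dim A > 0`)." B. Moonen, *Families of motives and the Mumford–Tate conjecture*,
Milan J. Math. 85 (2017) [Moonen2017FamiliesMotives] (held text
`paper:doi-10-1007-s00032-017-0273-x`, p. 3), §2.1: "This category `HS_ℚ` is a neutral Tannakian
category; in particular we have direct sums, tensor products and duals; on the underlying
`ℚ`-vector spaces they are given by the usual constructions." P. Deligne, *Théorie de Hodge II*
[DeligneHodgeII1971], 1.1.12 (the filtration `Fᵖ(⊗ᵢ Vᵢ) = Σ_{Σ aᵢ ≥ p} ⊗ᵢ F^{aᵢ} Vᵢ` of a tensor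
product of filtered objects; `⊗` is a functor of filtered objects) and 2.1.13–2.1.14 (Tate twists).

A Tannakian subcategory is closed under `⊗`; in particular under tensor powers `H ↦ H^{⊗ k}`. For
the single-triple predicate this needs ONE abelian variety only: if `H` is a direct summand of
`(H¹(A)^{⊗ m})(c)` through `(j, r)`, then `H^{⊗ k}` is a direct summand of
`((H¹(A)^{⊗ m})(c))^{⊗ k} ≅ (H¹(A)^{⊗ km})(kc)` through `(j^{⊗ k}, r^{⊗ k})` and the flattening
isomorphism. This file supplies the three ingredients and the conclusion.

## What is proved

Multilinear algebra over a commutative ring `R` (module `M`; `M` free where marked):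
* `HodgeStructure.nestedTprod R M k m` — the nested pure tensor `w ↦ ⊗ⱼ (⊗ᵢ w (j, i))`,
  MULTILINEAR in the family `w : Fin k × Fin m → M` (definition with body);
* `HodgeStructure.tensorPowerUnflatten R M k m : M^{⊗ km} ≃ₗ[R] (M^{⊗ m})^{⊗ k}` (for `M`
  free) — the flattening/associativity isomorphism of iterated tensor powers, `⊗ₗ wₗ ↦
  ⊗ⱼ ⊗ᵢ w_{jm+i}` (`tensorPowerUnflatten_tprod`, `tensorPowerUnflatten_symm_tprod_tprod`;
  indices through Mathlib's `finProdFinEquiv`). Mathlib has no associativity of `PiTensorProduct`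
  at the pinned commit ("No lemmas about associativity", `PiTensorProduct/Basic`); the map is
  `PiTensorProduct.lift` of `nestedTprod`, bijective because it matches the tensor bases
  `Basis.piTensorProduct`;
* `HodgeStructure.piTensorFiltration G ι p = Σ_{p ≤ Σ aᵢ} ⊗ᵢ G (aᵢ)` — Deligne's filtration on
  `⨂_ι Y` induced by a `ℤ`-indexed family of submodules `G` (definition with body; the tree's
  `HodgeStructure.tensorPowerFiltration` is its pull-back along the comparison
  `piTensorBaseChange`, `tensorPowerFiltration_eq_comap_piTensorFiltration`), with its span
  description, functoriality (`map_piTensorFiltration_le`), shift under `G ↦ G (· + c)`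
  (`piTensorFiltration_shift`), transport along equivalences (`piTensorFiltration_comap_equiv`)
  and FLATTENING `U (Fᵖ(Y^{⊗ km})) = Fᵖ((Y^{⊗ m})^{⊗ k})`
  (`map_tensorPowerUnflatten_piTensorFiltration`).

Hodge structures (`H : HodgeStructure V n`; the standing tensor facts `[HodgeTensorFacts]` are
the tree's theorem `hodgeTensorFacts_holds`):
* `Hom.tensorPowerMap f k : Hom (H₁^{⊗ k}) (H₂^{⊗ k})` — `f ↦ f^{⊗ k}` on morphisms (Deligne, Hodge
  II, 1.1.12: `⊗` is a functor of filtered objects), with `Hom.tensorPowerMap_retract`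
  (`r ∘ j = id ⇒ r^{⊗ k} ∘ j^{⊗ k} = id`);
* `tensorPowerFiltration_tateTwist` — `Fᵖ((H(c))^{⊗ k}) = F^{p + kc}(H^{⊗ k})`, i.e.
  `(H(c))^{⊗ k} = H^{⊗ k}(kc)` (Hodge II, 2.1.14);
* `comap_tensorPowerUnflatten_tensorPowerFiltration` — `Fᵖ(H^{⊗ km})` is the pull-back of
  `Fᵖ((H^{⊗ m})^{⊗ k})` along the flattening, whence the morphisms of Hodge structures
  `Hom.tensorPowerUnflatten H k m : H^{⊗ km} → (H^{⊗ m})^{⊗ k}` and `Hom.tensorPowerFlatten`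
  (an isomorphism: `Hom.tensorPowerFlatten_tensorPowerUnflatten_apply` and its companion);
* `Hom.ofComapBaseChange` / `Hom.symmOfComapBaseChange` — a `ℚ`-linear equivalence along whose
  complexification the filtrations correspond is an isomorphism of Hodge structures (both
  directions are morphisms);
* **`IsOfAbelianType.tensorPower`** — if `H` is of abelian type then so is `H^{⊗ k}`
  (`(A, m, c) ↦ (A, km, kc)`); **`IsOfAbelianType.exteriorPower`** — and so is `⋀ᵏ H` (by the
  tree's `IsOfAbelianType.exteriorPower_of_tensorPower`);
* instances: `isOfAbelianType_hodgeStructure_tensorPower` / `_exteriorPower` — every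
  `Hⁿ(A(ℂ); ℚ)^{⊗ k}` and `⋀ᵏ Hⁿ(A(ℂ); ℚ)` of a complex abelian variety is of abelian type;
  `isOfAbelianType_abelianTensor_tensorPower`.

Not here (deliberately): closure under binary `⊗` and `⊕` of two structures of abelian type
presented through DIFFERENT abelian varieties (this needs `H¹(A)` as a direct summand of
`H¹(A × A')`, i.e. products of abelian varieties; sibling files).
-/

noncomputable section

open scoped TensorProduct

namespace Literature.AlgebraicGeometry.Motives

namespace HodgeStructure

/-! ### Multilinear algebra: the flattening isomorphism `M^{⊗ km} ≃ (M^{⊗ m})^{⊗ k}` -/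

section Flatten

universe u v

variable (R : Type u) [CommRing R] (M : Type v) [AddCommGroup M] [Module R M]

/-- **The nested pure tensor** `w ↦ ⊗ⱼ (⊗ᵢ w (j, i)) ∈ (M^{⊗ m})^{⊗ k}`, as a MULTILINEAR map in
the family `w : Fin k × Fin m → M`: updating `w` at `(j₀, i₀)` changes only the inner tensor at
`j₀`, in its slot `i₀` (`Function.curry_update`), where `⊗` is multilinear twice (Greub §1.20: the
`p`-linear universal map of an iterated tensor product).
[cite: Greub1978Multilinear, §1.20 Prop. 1.20.1 (PDF p. 21) and §3.1 (3.2) (PDF p. 45)] -/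
def nestedTprod (k m : ℕ) :
    MultilinearMap R (fun _ : Fin k × Fin m => M) (⨂[R]^k (⨂[R]^m M)) where
  toFun w := PiTensorProduct.tprod R fun j => PiTensorProduct.tprod R fun i => w (j, i)
  map_update_add' := by
    intro inst w ji x y
    have hinst : inst = instDecidableEqProd := Subsingleton.elim _ _
    subst hinst
    have key : ∀ z : M, (fun j => PiTensorProduct.tprod R fun i => Function.update w ji z (j, i)) =
        Function.update (fun j => PiTensorProduct.tprod R fun i => w (j, i)) ji.1
          (PiTensorProduct.tprod R (Function.update (fun i => w (ji.1, i)) ji.2 z)) := by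
      intro z
      have h1 : (fun j i => Function.update w ji z (j, i)) =
          Function.update (Function.curry w) ji.1
            (Function.update (Function.curry w ji.1) ji.2 z) :=
        Function.curry_update w ji z
      funext j
      have h2 := congrFun h1 j
      rw [show (fun i => Function.update w ji z (j, i)) =
        Function.update (Function.curry w) ji.1
          (Function.update (Function.curry w ji.1) ji.2 z) j from h2]
      rw [Function.apply_update (fun _ => PiTensorProduct.tprod R) (Function.curry w) ji.1
        (Function.update (Function.curry w ji.1) ji.2 z) j]
      rfl
    simp only [key, MultilinearMap.map_update_add]
  map_update_smul' := by
    intro inst w ji c x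
    have hinst : inst = instDecidableEqProd := Subsingleton.elim _ _
    subst hinst
    have key : ∀ z : M, (fun j => PiTensorProduct.tprod R fun i => Function.update w ji z (j, i)) =
        Function.update (fun j => PiTensorProduct.tprod R fun i => w (j, i)) ji.1
          (PiTensorProduct.tprod R (Function.update (fun i => w (ji.1, i)) ji.2 z)) := by
      intro z
      have h1 : (fun j i => Function.update w ji z (j, i)) =
          Function.update (Function.curry w) ji.1
            (Function.update (Function.curry w ji.1) ji.2 z) :=
        Function.curry_update w ji z
      funext j
      have h2 := congrFun h1 j
      rw [show (fun i => Function.update w ji z (j, i)) =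
        Function.update (Function.curry w) ji.1
          (Function.update (Function.curry w ji.1) ji.2 z) j from h2]
      rw [Function.apply_update (fun _ => PiTensorProduct.tprod R) (Function.curry w) ji.1
        (Function.update (Function.curry w ji.1) ji.2 z) j]
      rfl
    simp only [key, MultilinearMap.map_update_smul]

/-- `nestedTprod w = ⊗ⱼ (⊗ᵢ w (j, i))`.
[cite: Greub1978Multilinear, §1.20 Prop. 1.20.1 (PDF p. 21) and §3.1 (3.2) (PDF p. 45)] -/
@[simp]
theorem nestedTprod_apply (k m : ℕ) (w : Fin k × Fin m → M) :
    nestedTprod R M k m w =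
      PiTensorProduct.tprod R fun j => PiTensorProduct.tprod R fun i => w (j, i) :=
  rfl

/-- The unflattening LINEAR MAP `M^{⊗ km} → (M^{⊗ m})^{⊗ k}`, `⊗ₗ wₗ ↦ ⊗ⱼ ⊗ᵢ w_{jm+i}`:
`PiTensorProduct.lift` of `nestedTprod` re-indexed along Mathlib's
`finProdFinEquiv : Fin k × Fin m ≃ Fin (k m)` (Greub, Prop. 1.20.1: the associativity isomorphism is
induced by the factorisation property).
[cite: Greub1978Multilinear, §1.20 Prop. 1.20.1 (PDF p. 21) and §3.1 (3.2) (PDF p. 45)] -/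
def tensorPowerUnflattenMap (k m : ℕ) : (⨂[R]^(k * m) M) →ₗ[R] ⨂[R]^k (⨂[R]^m M) :=
  PiTensorProduct.lift ((nestedTprod R M k m).domDomCongr finProdFinEquiv)

/-- `tensorPowerUnflattenMap (⊗ₗ wₗ) = ⊗ⱼ ⊗ᵢ w (finProdFinEquiv (j, i))` (Greub (3.2):
`(x₁ ⊗ ⋯ ⊗ x_p) ⊗ (x_{p+1} ⊗ ⋯ ⊗ x_{p+q}) = x₁ ⊗ ⋯ ⊗ x_{p+q}`, iterated).
[cite: Greub1978Multilinear, §1.20 Prop. 1.20.1 (PDF p. 21) and §3.1 (3.2) (PDF p. 45)] -/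
@[simp]
theorem tensorPowerUnflattenMap_tprod (k m : ℕ) (w : Fin (k * m) → M) :
    tensorPowerUnflattenMap R M k m (PiTensorProduct.tprod R w) =
      PiTensorProduct.tprod R fun j => PiTensorProduct.tprod R fun i =>
        w (finProdFinEquiv (j, i)) := by
  simp [tensorPowerUnflattenMap]

/-- Index bookkeeping `(Fin (k m) → κ) ≃ (Fin k → Fin m → κ)` along `finProdFinEquiv` (matches the
index sets of the tensor bases of `M^{⊗ km}` and `(M^{⊗ m})^{⊗ k}`). [folklore] -/
def curryFinProd (κ : Type*) (k m : ℕ) : (Fin (k * m) → κ) ≃ (Fin k → Fin m → κ) where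
  toFun f j i := f (finProdFinEquiv (j, i))
  invFun g l := g (finProdFinEquiv.symm l).1 (finProdFinEquiv.symm l).2
  left_inv f := by
    funext l
    simp only [Prod.mk.eta, Equiv.apply_symm_apply]
  right_inv g := by
    funext j i
    simp only [Equiv.symm_apply_apply]

/-- For a free module the unflattening map is bijective: it carries the tensor basis
`⊗ₗ b_{f l}` of `M^{⊗ km}` (`Basis.piTensorProduct`) to the tensor basis `⊗ⱼ ⊗ᵢ b_{f (jm+i)}` of
`(M^{⊗ m})^{⊗ k}`, i.e. it is the linear equivalence `Basis.equiv` matching the two bases along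
`curryFinProd` (Greub §3.1: the products `e_{ν₁} ⊗ ⋯ ⊗ e_{ν_p}` of basis vectors form a basis of
`⊗ᵖ E`; Prop. 1.20.1: associativity is an isomorphism).
[cite: Greub1978Multilinear, §1.20 Prop. 1.20.1 (PDF p. 21) and §3.1 (3.2) (PDF p. 45)] -/
theorem tensorPowerUnflattenMap_bijective [Module.Free R M] (k m : ℕ) :
    Function.Bijective (tensorPowerUnflattenMap R M k m) := by
  classical
  let b := Module.Free.chooseBasis R M
  let B₁ := Basis.piTensorProduct (R := R) fun _ : Fin (k * m) => b
  let B₂ := Basis.piTensorProduct (R := R) fun _ : Fin k =>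
    Basis.piTensorProduct (R := R) fun _ : Fin m => b
  have h : tensorPowerUnflattenMap R M k m =
      (B₁.equiv B₂ (curryFinProd (Module.Free.ChooseBasisIndex R M) k m)).toLinearMap := by
    refine B₁.ext fun f => ?_
    rw [LinearEquiv.coe_toLinearMap, Module.Basis.equiv_apply]
    simp only [B₁, B₂, Basis.piTensorProduct_apply, tensorPowerUnflattenMap_tprod]
    rfl
  rw [h]
  exact LinearEquiv.bijective _

/-- **The flattening isomorphism of iterated tensor powers** `M^{⊗ km} ≃ₗ[R] (M^{⊗ m})^{⊗ k}` (for a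
free module `M`, e.g. any vector space), `⊗ₗ wₗ ↦ ⊗ⱼ ⊗ᵢ w_{jm+i}` (associativity of the tensor
product; on the underlying spaces the tensor constructions of Hodge structures "are given by the
usual constructions", Moonen §2.1; Greub, Prop. 1.20.1 and (3.2)).
[cite: Greub1978Multilinear, §1.20 Prop. 1.20.1 (PDF p. 21) and §3.1 (3.2) (PDF p. 45)]
[cite: Moonen2017FamiliesMotives, §2.1 (p. 3)] -/
def tensorPowerUnflatten [Module.Free R M] (k m : ℕ) :
    (⨂[R]^(k * m) M) ≃ₗ[R] ⨂[R]^k (⨂[R]^m M) :=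
  LinearEquiv.ofBijective (tensorPowerUnflattenMap R M k m)
    (tensorPowerUnflattenMap_bijective R M k m)

/-- `tensorPowerUnflatten (⊗ₗ wₗ) = ⊗ⱼ ⊗ᵢ w (finProdFinEquiv (j, i))` (Greub (3.2), iterated).
[cite: Greub1978Multilinear, §1.20 Prop. 1.20.1 (PDF p. 21) and §3.1 (3.2) (PDF p. 45)] -/
@[simp]
theorem tensorPowerUnflatten_tprod [Module.Free R M] (k m : ℕ) (w : Fin (k * m) → M) :
    tensorPowerUnflatten R M k m (PiTensorProduct.tprod R w) =
      PiTensorProduct.tprod R fun j => PiTensorProduct.tprod R fun i =>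
        w (finProdFinEquiv (j, i)) := by
  simp [tensorPowerUnflatten]

/-- The flattening direction on nested pure tensors:
`tensorPowerUnflatten⁻¹ (⊗ⱼ ⊗ᵢ w j i) = ⊗ₗ w (l / m) (l % m)` (indices through
`finProdFinEquiv.symm`; Greub (3.2), iterated).
[cite: Greub1978Multilinear, §1.20 Prop. 1.20.1 (PDF p. 21) and §3.1 (3.2) (PDF p. 45)] -/
theorem tensorPowerUnflatten_symm_tprod_tprod [Module.Free R M] (k m : ℕ) (w : Fin k → Fin m → M) :
    (tensorPowerUnflatten R M k m).symm
        (PiTensorProduct.tprod R fun j => PiTensorProduct.tprod R fun i => w j i) =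
      PiTensorProduct.tprod R fun l =>
        w (finProdFinEquiv.symm l).1 (finProdFinEquiv.symm l).2 := by
  rw [LinearEquiv.symm_apply_eq, tensorPowerUnflatten_tprod]
  simp only [Equiv.symm_apply_apply]

end Flatten

/-! ### Deligne's filtration on a tensor power of a filtered module

For a family of submodules `G : ℤ → Submodule R Y` (a decreasing filtration in the applications)
and a finite index type `ι`, `piTensorFiltration G ι p = Σ_{p ≤ Σ aᵢ} im(⊗ᵢ G (aᵢ) → ⊗ᵢ Y)`
(Deligne, Hodge II, 1.1.12). The tree's `HodgeStructure.tensorPowerFiltration H k p` is the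
pull-back of `piTensorFiltration H.F (Fin k) p` along the comparison isomorphism
`piTensorBaseChange V (Fin k) : ℂ ⊗ V^{⊗ k} → (ℂ ⊗ V)^{⊗ k}`
(`tensorPowerFiltration_eq_comap_piTensorFiltration` below); the lemmas of this section are the
`ℂ`-side computations. -/

section PiTensorFiltration

universe u v w

variable {R : Type u} [CommRing R] {Y : Type v} [AddCommGroup Y] [Module R Y]

/-- **Deligne's filtration on `⨂_ι Y`** induced by `G : ℤ → Submodule R Y`:
`Fᵖ(⨂_ι Y) = Σ_{p ≤ Σᵢ aᵢ} im(⨂ᵢ G (aᵢ) ↪ ⨂ᵢ Y)` (the sum over multi-indices `a : ι → ℤ`; with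
`p ≤ Σ aᵢ` rather than `=`, the same subspace for decreasing `G` and nonempty `ι`, as in the tree's
`HodgeStructure.tensorPowerFiltration`). [cite: DeligneHodgeII1971, 1.1.12] -/
def piTensorFiltration (G : ℤ → Submodule R Y) (ι : Type w) [Fintype ι] (p : ℤ) :
    Submodule R (⨂[R] _ : ι, Y) :=
  ⨆ (a : ι → ℤ) (_ : p ≤ ∑ i, a i), LinearMap.range (PiTensorProduct.mapIncl fun i => G (a i))

variable {ι : Type w} [Fintype ι]

omit [Fintype ι] in
/-- `im(⨂ᵢ Nᵢ ↪ ⨂ᵢ Y) = span {⊗ᵢ xᵢ | xᵢ ∈ Nᵢ}` (Mathlib's `PiTensorProduct.map_range_eq_span_tprod`,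
unbundled). Private plumbing. [folklore] -/
private theorem range_mapIncl_eq_span (N : ι → Submodule R Y) :
    LinearMap.range (PiTensorProduct.mapIncl N) =
      Submodule.span R {t | ∃ x : ι → Y, (∀ i, x i ∈ N i) ∧ PiTensorProduct.tprod R x = t} := by
  rw [PiTensorProduct.mapIncl, PiTensorProduct.map_range_eq_span_tprod]
  congr 1
  ext t
  constructor
  · rintro ⟨m, rfl⟩
    exact ⟨fun i => (m i : Y), fun i => (m i).2, rfl⟩
  · rintro ⟨x, hx, rfl⟩
    exact ⟨fun i => ⟨x i, hx i⟩, rfl⟩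

/-- Span description: `Fᵖ(⨂_ι Y)` is spanned by the pure tensors `⊗ᵢ xᵢ` with `xᵢ ∈ G (aᵢ)`,
`p ≤ Σ aᵢ`. [cite: DeligneHodgeII1971, 1.1.12] -/
theorem piTensorFiltration_eq_span (G : ℤ → Submodule R Y) (p : ℤ) :
    piTensorFiltration G ι p = Submodule.span R {t | ∃ (a : ι → ℤ) (x : ι → Y),
      p ≤ ∑ i, a i ∧ (∀ i, x i ∈ G (a i)) ∧ PiTensorProduct.tprod R x = t} := by
  apply le_antisymm
  · refine iSup_le fun a => iSup_le fun ha => ?_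
    rw [range_mapIncl_eq_span, Submodule.span_le]
    rintro _ ⟨x, hx, rfl⟩
    exact Submodule.subset_span ⟨a, x, ha, hx, rfl⟩
  · rw [Submodule.span_le]
    rintro _ ⟨a, x, ha, hx, rfl⟩
    refine Submodule.mem_iSup_of_mem a (Submodule.mem_iSup_of_mem ha ?_)
    exact ⟨PiTensorProduct.tprod R fun i => ⟨x i, hx i⟩, by
      rw [PiTensorProduct.mapIncl, PiTensorProduct.map_tprod]; rfl⟩

/-- A pure tensor `⊗ᵢ xᵢ` with `xᵢ ∈ G (aᵢ)` and `p ≤ Σ aᵢ` lies in `Fᵖ(⨂_ι Y)`.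
[cite: DeligneHodgeII1971, 1.1.12] -/
theorem tprod_mem_piTensorFiltration (G : ℤ → Submodule R Y) {p : ℤ} (a : ι → ℤ)
    (ha : p ≤ ∑ i, a i) (x : ι → Y) (hx : ∀ i, x i ∈ G (a i)) :
    PiTensorProduct.tprod R x ∈ piTensorFiltration G ι p := by
  rw [piTensorFiltration_eq_span]
  exact Submodule.subset_span ⟨a, x, ha, hx, rfl⟩

/-- The filtration `p ↦ Fᵖ(⨂_ι Y)` is decreasing. [cite: DeligneHodgeII1971, 1.1.12] -/
theorem piTensorFiltration_antitone (G : ℤ → Submodule R Y) :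
    Antitone (piTensorFiltration G ι) :=
  fun _ _ h => iSup_mono fun _ => iSup_mono' fun ha => ⟨h.trans ha, le_rfl⟩

/-- **Functoriality** (Deligne, Hodge II, 1.1.12: `⊗` is a functor of filtered objects): a linear
map `g : Y → Y'` with `g (G q) ⊆ G' q` for all `q` induces `⊗ g : Fᵖ(⨂_ι Y) → Fᵖ(⨂_ι Y')`.
[cite: DeligneHodgeII1971, 1.1.12] -/
theorem map_piTensorFiltration_le {Y' : Type*} [AddCommGroup Y'] [Module R Y']
    (G : ℤ → Submodule R Y) (G' : ℤ → Submodule R Y') (g : Y →ₗ[R] Y')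
    (hg : ∀ q, (G q).map g ≤ G' q) (p : ℤ) :
    (piTensorFiltration G ι p).map (PiTensorProduct.map fun _ : ι => g) ≤
      piTensorFiltration G' ι p := by
  rw [piTensorFiltration_eq_span, Submodule.map_span, Submodule.span_le]
  rintro _ ⟨_, ⟨a, x, ha, hx, rfl⟩, rfl⟩
  rw [PiTensorProduct.map_tprod]
  exact tprod_mem_piTensorFiltration G' a ha _ fun i => hg _ ⟨x i, hx i, rfl⟩

/-- **Shift** (Tate twist on the factors): the filtration induced by `q ↦ G (q + c)` is the
filtration induced by `G` shifted by `|ι| c`: `Fᵖ = F^{p + |ι| c}` (Deligne, Hodge II, 2.1.14: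
`(H(c))^{⊗ r} = H^{⊗ r}(rc)`). [cite: DeligneHodgeII1971, 1.1.12 and 2.1.14] -/
theorem piTensorFiltration_shift (G : ℤ → Submodule R Y) (c p : ℤ) :
    piTensorFiltration (fun q => G (q + c)) ι p =
      piTensorFiltration G ι (p + Fintype.card ι * c) := by
  apply le_antisymm
  · refine iSup_le fun a => iSup_le fun ha => ?_
    refine le_iSup₂_of_le (fun i => a i + c) ?_ le_rfl
    rw [Finset.sum_add_distrib, Finset.sum_const, Finset.card_univ, nsmul_eq_mul]
    omega
  · refine iSup_le fun b => iSup_le fun hb => ?_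
    refine le_iSup₂_of_le (fun i => b i - c) ?_ ?_
    · rw [Finset.sum_sub_distrib, Finset.sum_const, Finset.card_univ, nsmul_eq_mul]
      omega
    · rw [range_mapIncl_eq_span, range_mapIncl_eq_span]
      simp only [sub_add_cancel, le_refl]

/-- **Transport along a linear equivalence** `e : Y ≃ Y'`: the filtration induced by the pulled
back family `q ↦ e⁻¹(G' q)` is the pull-back along `⊗ e` of the filtration induced by `G'`.
[cite: DeligneHodgeII1971, 1.1.12] -/
theorem piTensorFiltration_comap_equiv {Y' : Type*} [AddCommGroup Y'] [Module R Y']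
    (G' : ℤ → Submodule R Y') (e : Y ≃ₗ[R] Y') (p : ℤ) :
    piTensorFiltration (fun q => (G' q).comap (e : Y →ₗ[R] Y')) ι p =
      (piTensorFiltration G' ι p).comap (PiTensorProduct.map fun _ : ι => (e : Y →ₗ[R] Y')) := by
  apply le_antisymm
  · rw [← Submodule.map_le_iff_le_comap]
    exact map_piTensorFiltration_le _ _ _ (fun q => Submodule.map_comap_le _ _) p
  · intro z hz
    rw [Submodule.mem_comap] at hz
    have hzz : (PiTensorProduct.map fun _ : ι => (e.symm : Y' →ₗ[R] Y))
        ((PiTensorProduct.map fun _ : ι => (e : Y →ₗ[R] Y')) z) = z := by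
      rw [← LinearMap.comp_apply, ← PiTensorProduct.map_comp]
      have : (fun _ : ι => (e.symm : Y' →ₗ[R] Y) ∘ₗ (e : Y →ₗ[R] Y')) =
          fun _ => (LinearMap.id : Y →ₗ[R] Y) :=
        funext fun _ => LinearMap.ext fun y => e.symm_apply_apply y
      rw [this, PiTensorProduct.map_id, LinearMap.id_apply]
    rw [← hzz]
    refine map_piTensorFiltration_le G' _ (e.symm : Y' →ₗ[R] Y) (fun q => ?_) p ⟨_, hz, rfl⟩
    rintro _ ⟨y, hy, rfl⟩
    simpa using hy

/-- **Flattening identifies Deligne's filtrations**: under `U : Y^{⊗ km} ≃ (Y^{⊗ m})^{⊗ k}`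
(`tensorPowerUnflatten`), `U (Fᵖ(Y^{⊗ km})) = Fᵖ((Y^{⊗ m})^{⊗ k})`, the latter built from the
filtration `q ↦ F^q(Y^{⊗ m})` on the factors: a multi-index `a : Fin (km) → ℤ` is a family of
multi-indices `(a_{j,·})ⱼ` with `Σ_l a_l = Σⱼ (Σᵢ a_{j,i})` (for `⊇` one reduces to pure tensors of
pure tensors by multilinearity, the tree's `BaseChange.tprod_mem_of_mem_span`).
[cite: DeligneHodgeII1971, 1.1.12] -/
theorem map_tensorPowerUnflatten_piTensorFiltration [Module.Free R Y] (G : ℤ → Submodule R Y)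
    (k m : ℕ) (p : ℤ) :
    (piTensorFiltration G (Fin (k * m)) p).map (tensorPowerUnflatten R Y k m).toLinearMap =
      piTensorFiltration (piTensorFiltration G (Fin m)) (Fin k) p := by
  apply le_antisymm
  · rw [piTensorFiltration_eq_span G, Submodule.map_span, Submodule.span_le]
    rintro _ ⟨_, ⟨a, x, ha, hx, rfl⟩, rfl⟩
    rw [SetLike.mem_coe, LinearEquiv.coe_toLinearMap, tensorPowerUnflatten_tprod]
    refine tprod_mem_piTensorFiltration _ (fun j => ∑ i, a (finProdFinEquiv (j, i))) ?_ _
      fun j => tprod_mem_piTensorFiltration G (fun i => a (finProdFinEquiv (j, i))) le_rfl _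
        fun i => hx _
    calc p ≤ ∑ l, a l := ha
      _ = ∑ ji : Fin k × Fin m, a (finProdFinEquiv ji) := (Equiv.sum_comp finProdFinEquiv a).symm
      _ = ∑ j, ∑ i, a (finProdFinEquiv (j, i)) := Fintype.sum_prod_type _
  · refine iSup_le fun b => iSup_le fun hb => ?_
    rw [range_mapIncl_eq_span, Submodule.span_le]
    rintro _ ⟨t, ht, rfl⟩
    refine LinearAlgebra.BaseChange.tprod_mem_of_mem_span (R := R) _
      (fun j => {u | ∃ (a : Fin m → ℤ) (x : Fin m → Y), b j ≤ ∑ i, a i ∧ (∀ i, x i ∈ G (a i)) ∧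
        PiTensorProduct.tprod R x = u}) ?_ t fun j => by
          rw [← piTensorFiltration_eq_span]; exact ht j
    intro s hs
    choose a x hba hx hs using hs
    refine ⟨PiTensorProduct.tprod R fun l =>
      x (finProdFinEquiv.symm l).1 (finProdFinEquiv.symm l).2, ?_, ?_⟩
    · refine tprod_mem_piTensorFiltration G
        (fun l => a (finProdFinEquiv.symm l).1 (finProdFinEquiv.symm l).2) ?_ _ fun l => hx _ _
      calc p ≤ ∑ j, b j := hb
        _ ≤ ∑ j, ∑ i, a j i := Finset.sum_le_sum fun j _ => hba j
        _ = ∑ ji : Fin k × Fin m, a ji.1 ji.2 := (Fintype.sum_prod_type' a).symm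
        _ = ∑ l, a (finProdFinEquiv.symm l).1 (finProdFinEquiv.symm l).2 :=
          (Equiv.sum_comp finProdFinEquiv.symm (fun ji : Fin k × Fin m => a ji.1 ji.2)).symm
    · rw [LinearEquiv.coe_toLinearMap, tensorPowerUnflatten_tprod]
      simp only [Equiv.symm_apply_apply, hs]

end PiTensorFiltration

/-! ### Hodge structures: `f^{⊗ k}`, twists and flattening of tensor powers -/

section Hodge

universe u v

variable {V : Type u} [AddCommGroup V] [Module ℚ V]
variable {W : Type v} [AddCommGroup W] [Module ℚ W]
variable {n : ℤ}

/-- The tree's tensor-power filtration is Deligne's filtration `piTensorFiltration H.F (Fin k)` on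
`(ℂ ⊗ V)^{⊗ k}` pulled back along the comparison isomorphism
`piTensorBaseChange V (Fin k) : ℂ ⊗ V^{⊗ k} → (ℂ ⊗ V)^{⊗ k}` (bijective,
`piTensorBaseChange_bijective`; pull-backs along an isomorphism commute with `Σ`).
[cite: DeligneHodgeII1971, 1.1.12] -/
theorem tensorPowerFiltration_eq_comap_piTensorFiltration (H : HodgeStructure V n) (k : ℕ)
    (p : ℤ) :
    H.tensorPowerFiltration k p =
      (piTensorFiltration H.F (Fin k) p).comap (piTensorBaseChange V (Fin k)) := by
  set e := LinearEquiv.ofBijective _ (piTensorBaseChange_bijective V (Fin k)) with he_def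
  have he : (e : _ →ₗ[ℂ] _) = piTensorBaseChange V (Fin k) := LinearMap.ext fun _ ↦ rfl
  have hcomap : ∀ S : Submodule ℂ (⨂[ℂ] _ : Fin k, (ℂ ⊗[ℚ] V)),
      S.comap (piTensorBaseChange V (Fin k)) = S.map (e.symm : _ →ₗ[ℂ] _) := fun S ↦ by
    rw [← he, Submodule.comap_equiv_eq_map_symm]
  rw [tensorPowerFiltration, piTensorFiltration]
  simp_rw [hcomap, ← Submodule.map_iSup]

/-- `piTensorBaseChange` is natural in linear maps (two universes):
`c ((⊗ f) ⊗ ℂ) = (⊗ (f ⊗ ℂ)) c`. Private plumbing (the tree's one-universe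
`piTensorBaseChange_map_baseChange` lives in `MumfordTateRankInvariance`). [folklore] -/
private theorem piTensorBaseChange_piMap_baseChange {ι : Type} [Fintype ι] [DecidableEq ι]
    (f : V →ₗ[ℚ] W) (x : ℂ ⊗[ℚ] (⨂[ℚ] _ : ι, V)) :
    piTensorBaseChange W ι ((PiTensorProduct.map fun _ ↦ f).baseChange ℂ x) =
      PiTensorProduct.map (fun _ ↦ f.baseChange ℂ) (piTensorBaseChange V ι x) := by
  induction x using TensorProduct.induction_on with
  | zero => simp
  | add x y hx hy => simp only [map_add, hx, hy]
  | tmul c z =>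
    induction z using PiTensorProduct.induction_on with
    | smul_tprod r v =>
      simp [LinearMap.baseChange_tmul, piTensorBaseChange_tmul_tprod, TensorProduct.tmul_smul,
        PiTensorProduct.map_tprod, ofRat_apply, LinearMap.baseChange_tmul]
    | add x y hx hy => simp only [TensorProduct.tmul_add, map_add, hx, hy]

/-- **`⊗` is a functor of filtered objects, on `ℚ`-Hodge structures:** if the complexification of a
`ℚ`-linear `f : V → W` maps `Fᵖ H₁` into `Fᵖ H₂` for all `p`, then the complexification of
`f^{⊗ k}` maps `Fᵖ(H₁^{⊗ k})` into `Fᵖ(H₂^{⊗ k})`. [cite: DeligneHodgeII1971, 1.1.12] -/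
theorem map_tensorPowerFiltration_le (H₁ : HodgeStructure V n) (H₂ : HodgeStructure W n)
    (f : V →ₗ[ℚ] W) (hf : ∀ q, (H₁.F q).map (f.baseChange ℂ) ≤ H₂.F q) (k : ℕ) (p : ℤ) :
    (H₁.tensorPowerFiltration k p).map ((PiTensorProduct.map fun _ : Fin k ↦ f).baseChange ℂ) ≤
      H₂.tensorPowerFiltration k p := by
  rw [tensorPowerFiltration_eq_comap_piTensorFiltration,
    tensorPowerFiltration_eq_comap_piTensorFiltration, Submodule.map_le_iff_le_comap]
  intro Z hZ
  rw [Submodule.mem_comap] at hZ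
  rw [Submodule.mem_comap, Submodule.mem_comap, piTensorBaseChange_piMap_baseChange]
  exact map_piTensorFiltration_le H₁.F H₂.F (f.baseChange ℂ) hf p ⟨_, hZ, rfl⟩

section TensorPowerMap

variable [HodgeTensorFacts.{u, u}] [HodgeTensorFacts.{v, v}]

/-- **The tensor power of a morphism of Hodge structures** `f : H₁ → H₂` is the morphism
`f^{⊗ k} : H₁^{⊗ k} → H₂^{⊗ k}` (same weight `kn`) with underlying map `⊗ (f, …, f)` (Mathlib's
`PiTensorProduct.map`): Deligne, Hodge II, 1.1.12 (`⊗` of filtered objects is functorial); Moonen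
§2.1 ("tensor products … given by the usual constructions"); Voisin I Def. 11.39 (tensor product of
Hodge structures) with Def. 7.22 (morphisms). [cite: DeligneHodgeII1971, 1.1.12]
[cite: Moonen2017FamiliesMotives, §2.1 (p. 3)]
[cite: VoisinHodgeI2002, §11.3.3 Def. 11.39 (PDF p. 236)] -/
def Hom.tensorPowerMap {H₁ : HodgeStructure V n} {H₂ : HodgeStructure W n} (f : Hom H₁ H₂)
    (k : ℕ) : Hom (H₁.tensorPower k) (H₂.tensorPower k) where
  toLinearMap := PiTensorProduct.map fun _ : Fin k ↦ f.toLinearMap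
  map_F_le p := map_tensorPowerFiltration_le H₁ H₂ f.toLinearMap f.map_F_le k p

/-- The underlying map of `f^{⊗ k}` is `⊗ (f, …, f)`. [cite: DeligneHodgeII1971, 1.1.12] -/
@[simp]
theorem Hom.tensorPowerMap_toLinearMap {H₁ : HodgeStructure V n} {H₂ : HodgeStructure W n}
    (f : Hom H₁ H₂) (k : ℕ) :
    (Hom.tensorPowerMap f k).toLinearMap = PiTensorProduct.map fun _ : Fin k ↦ f.toLinearMap :=
  rfl

/-- **Retracts pass to tensor powers**: if `r ∘ j = id` then `r^{⊗ k} ∘ j^{⊗ k} = id` (functoriality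
`(r ∘ j)^{⊗ k} = r^{⊗ k} ∘ j^{⊗ k}`, `id^{⊗ k} = id`). [cite: DeligneHodgeII1971, 1.1.12]
[cite: VoisinHodgeI2002, §7.3.1 Def. 7.22 (PDF p. 147)] -/
theorem Hom.tensorPowerMap_retract {H₁ : HodgeStructure V n} {H₂ : HodgeStructure W n}
    (j : Hom H₁ H₂) (r : Hom H₂ H₁) (hjr : ∀ v, r.toLinearMap (j.toLinearMap v) = v) (k : ℕ)
    (x : ⨂[ℚ]^k V) :
    (Hom.tensorPowerMap r k).toLinearMap ((Hom.tensorPowerMap j k).toLinearMap x) = x := by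
  show PiTensorProduct.map (fun _ : Fin k ↦ r.toLinearMap)
    (PiTensorProduct.map (fun _ : Fin k ↦ j.toLinearMap) x) = x
  rw [← LinearMap.comp_apply, ← PiTensorProduct.map_comp]
  have : (fun _ : Fin k ↦ r.toLinearMap ∘ₗ j.toLinearMap) = fun _ ↦ (LinearMap.id : V →ₗ[ℚ] V) :=
    funext fun _ ↦ LinearMap.ext hjr
  rw [this, PiTensorProduct.map_id, LinearMap.id_apply]

end TensorPowerMap

/-- **Tensor powers commute with Tate twists**: `Fᵖ((H(c))^{⊗ k}) = F^{p + kc}(H^{⊗ k})`, i.e.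
`(H(c))^{⊗ k} = H^{⊗ k}(kc)` on the same space (Deligne, Hodge II, 2.1.14, `H(c) = H ⊗ ℚ(c)` and
`ℚ(c)^{⊗ k} = ℚ(kc)`). [cite: DeligneHodgeII1971, 2.1.13–2.1.14] -/
theorem tensorPowerFiltration_tateTwist (H : HodgeStructure V n) (c : ℤ) (k : ℕ) (p : ℤ) :
    (H.tateTwist c).tensorPowerFiltration k p = H.tensorPowerFiltration k (p + k * c) := by
  rw [tensorPowerFiltration_eq_comap_piTensorFiltration,
    tensorPowerFiltration_eq_comap_piTensorFiltration]
  have hF : (H.tateTwist c).F = fun q ↦ H.F (q + c) := rfl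
  rw [hF, piTensorFiltration_shift, Fintype.card_fin]

/-- **A linear equivalence along which the Hodge filtrations correspond is a morphism**: if
`e : V ≃ W` satisfies `e_ℂ⁻¹(Fᵖ H₂) = Fᵖ H₁` for all `p`, then `e` underlies a morphism `H₁ → H₂`
(an isomorphism of Hodge structures, inverse `Hom.symmOfComapBaseChange`; Deligne, Hodge II,
2.3.5; Voisin I Def. 7.22: a morphism is a map whose `ℂ`-linear extension satisfies
`φ(Fᵖ V_ℂ) ⊆ Fᵖ W_ℂ`). [cite: VoisinHodgeI2002, §7.3.1 Def. 7.22 (PDF p. 147)] -/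
def Hom.ofComapBaseChange {H₁ : HodgeStructure V n} {H₂ : HodgeStructure W n} (e : V ≃ₗ[ℚ] W)
    (h : ∀ p, (H₂.F p).comap (e.toLinearMap.baseChange ℂ) = H₁.F p) : Hom H₁ H₂ where
  toLinearMap := e.toLinearMap
  map_F_le p := by
    rw [← h p]
    exact Submodule.map_comap_le _ _

/-- The underlying map of `Hom.ofComapBaseChange e h` is `e`.
[cite: VoisinHodgeI2002, §7.3.1 Def. 7.22 (PDF p. 147)] -/
@[simp]
theorem Hom.ofComapBaseChange_toLinearMap {H₁ : HodgeStructure V n} {H₂ : HodgeStructure W n}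
    (e : V ≃ₗ[ℚ] W) (h : ∀ p, (H₂.F p).comap (e.toLinearMap.baseChange ℂ) = H₁.F p) :
    (Hom.ofComapBaseChange e h).toLinearMap = e.toLinearMap :=
  rfl

/-- `e_ℂ (e⁻¹_ℂ y) = y` for the complexifications of a linear equivalence and its inverse.
Private plumbing. [folklore] -/
private theorem baseChange_apply_symm_baseChange_apply (e : V ≃ₗ[ℚ] W) (y : ℂ ⊗[ℚ] W) :
    e.toLinearMap.baseChange ℂ (e.symm.toLinearMap.baseChange ℂ y) = y := by
  rw [← LinearMap.comp_apply, ← LinearMap.baseChange_comp]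
  have : e.toLinearMap ∘ₗ e.symm.toLinearMap = LinearMap.id := LinearMap.ext e.apply_symm_apply
  rw [this, LinearMap.baseChange_id, LinearMap.id_apply]

/-- The inverse direction of `Hom.ofComapBaseChange`: under the same hypothesis `e⁻¹` underlies a
morphism `H₂ → H₁`. [cite: VoisinHodgeI2002, §7.3.1 Def. 7.22 (PDF p. 147)] -/
def Hom.symmOfComapBaseChange {H₁ : HodgeStructure V n} {H₂ : HodgeStructure W n}
    (e : V ≃ₗ[ℚ] W) (h : ∀ p, (H₂.F p).comap (e.toLinearMap.baseChange ℂ) = H₁.F p) :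
    Hom H₂ H₁ where
  toLinearMap := e.symm.toLinearMap
  map_F_le p := by
    rintro _ ⟨y, hy, rfl⟩
    rw [← h p, Submodule.mem_comap, baseChange_apply_symm_baseChange_apply]
    exact hy

/-- The underlying map of `Hom.symmOfComapBaseChange e h` is `e⁻¹`.
[cite: VoisinHodgeI2002, §7.3.1 Def. 7.22 (PDF p. 147)] -/
@[simp]
theorem Hom.symmOfComapBaseChange_toLinearMap {H₁ : HodgeStructure V n} {H₂ : HodgeStructure W n}
    (e : V ≃ₗ[ℚ] W) (h : ∀ p, (H₂.F p).comap (e.toLinearMap.baseChange ℂ) = H₁.F p) :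
    (Hom.symmOfComapBaseChange e h).toLinearMap = e.symm.toLinearMap :=
  rfl

/-- `Hom.symmOfComapBaseChange` is a left inverse of `Hom.ofComapBaseChange` (the two are mutually
inverse isomorphisms of Hodge structures).
[cite: VoisinHodgeI2002, §7.3.1 Def. 7.22 (PDF p. 147)] -/
theorem Hom.symmOfComapBaseChange_ofComapBaseChange_apply {H₁ : HodgeStructure V n}
    {H₂ : HodgeStructure W n} (e : V ≃ₗ[ℚ] W)
    (h : ∀ p, (H₂.F p).comap (e.toLinearMap.baseChange ℂ) = H₁.F p) (v : V) :
    (Hom.symmOfComapBaseChange e h).toLinearMap ((Hom.ofComapBaseChange e h).toLinearMap v) = v :=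
  e.symm_apply_apply v

/-- `Hom.ofComapBaseChange` is a left inverse of `Hom.symmOfComapBaseChange`.
[cite: VoisinHodgeI2002, §7.3.1 Def. 7.22 (PDF p. 147)] -/
theorem Hom.ofComapBaseChange_symmOfComapBaseChange_apply {H₁ : HodgeStructure V n}
    {H₂ : HodgeStructure W n} (e : V ≃ₗ[ℚ] W)
    (h : ∀ p, (H₂.F p).comap (e.toLinearMap.baseChange ℂ) = H₁.F p) (w : W) :
    (Hom.ofComapBaseChange e h).toLinearMap ((Hom.symmOfComapBaseChange e h).toLinearMap w) = w :=
  e.apply_symm_apply w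

/-- **Base-change square for the flattening**: after complexification and the comparison maps
`piTensorBaseChange` (outer, then on each factor), the `ℚ`-flattening `tensorPowerUnflatten ℚ V`
becomes the `ℂ`-flattening `tensorPowerUnflatten ℂ (ℂ ⊗ V)` (both sides agree on
`c ⊗ (⊗ₗ vₗ)`, which span). Private plumbing. [folklore] -/
private theorem piTensorBaseChange_tensorPowerUnflatten_baseChange (k m : ℕ)
    (Z : ℂ ⊗[ℚ] ⨂[ℚ]^(k * m) V) :
    PiTensorProduct.map (fun _ : Fin k ↦ piTensorBaseChange V (Fin m))
        (piTensorBaseChange (⨂[ℚ]^m V) (Fin k)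
          ((tensorPowerUnflatten ℚ V k m).toLinearMap.baseChange ℂ Z)) =
      tensorPowerUnflatten ℂ (ℂ ⊗[ℚ] V) k m (piTensorBaseChange V (Fin (k * m)) Z) := by
  induction Z using TensorProduct.induction_on with
  | zero => simp only [map_zero]
  | add x y hx hy => simp only [map_add, hx, hy]
  | tmul c z =>
    induction z using PiTensorProduct.induction_on with
    | smul_tprod r v =>
      rw [← TensorProduct.smul_tmul]
      obtain ⟨d, hd⟩ : ∃ d : ℂ, r • c = d := ⟨_, rfl⟩
      rw [hd]
      simp [LinearMap.baseChange_tmul, piTensorBaseChange_tmul_tprod,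
        PiTensorProduct.map_tprod, ofRat_apply, tensorPowerUnflatten_tprod]
    | add x y hx hy => simp only [TensorProduct.tmul_add, map_add, hx, hy]

/-- **The flattening is an isomorphism of Hodge structures `H^{⊗ km} ≅ (H^{⊗ m})^{⊗ k}`, on
filtrations:** `Fᵖ(H^{⊗ km})` is the pull-back of `Fᵖ((H^{⊗ m})^{⊗ k})` along the
complexification of `tensorPowerUnflatten ℚ V k m` — Deligne's filtration of an iterated tensor
product is the filtration of the flattened tensor product (`F^p(⊗_j (⊗_i V)) = Σ_{Σ_{j,i} a_{ji} ≥ p}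
⊗_{j,i} F^{a_{ji}}`, Hodge II 1.1.12), read through the comparison maps
(`piTensorBaseChange_tensorPowerUnflatten_baseChange`, `map_tensorPowerUnflatten_piTensorFiltration`,
`piTensorFiltration_comap_equiv`). [cite: DeligneHodgeII1971, 1.1.12] -/
theorem comap_tensorPowerUnflatten_tensorPowerFiltration [HodgeTensorFacts.{u, u}]
    (H : HodgeStructure V n) (k m : ℕ) (p : ℤ) :
    ((H.tensorPower m).tensorPowerFiltration k p).comap
        ((tensorPowerUnflatten ℚ V k m).toLinearMap.baseChange ℂ) =
      H.tensorPowerFiltration (k * m) p := by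
  set cm := LinearEquiv.ofBijective _ (piTensorBaseChange_bijective V (Fin m)) with hcm_def
  have hcm : (cm : _ →ₗ[ℂ] _) = piTensorBaseChange V (Fin m) := LinearMap.ext fun _ ↦ rfl
  have hFm : (H.tensorPower m).F =
      fun q ↦ (piTensorFiltration H.F (Fin m) q).comap (cm : _ →ₗ[ℂ] _) := by
    funext q
    rw [tensorPower_F, tensorPowerFiltration_eq_comap_piTensorFiltration, hcm]
  rw [tensorPowerFiltration_eq_comap_piTensorFiltration,
    tensorPowerFiltration_eq_comap_piTensorFiltration, hFm, piTensorFiltration_comap_equiv,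
    ← map_tensorPowerUnflatten_piTensorFiltration, Submodule.map_equiv_eq_comap_symm]
  ext Z
  simp only [Submodule.mem_comap, hcm, LinearEquiv.coe_coe]
  rw [piTensorBaseChange_tensorPowerUnflatten_baseChange, LinearEquiv.symm_apply_apply]

section FlattenHom

variable [HodgeTensorFacts.{u, u}]

/-- **The unflattening morphism of Hodge structures `H^{⊗ km} → (H^{⊗ m})^{⊗ k}`** (weights matched
by `HodgeStructure.cast`), underlying map `tensorPowerUnflatten ℚ V k m`; with
`Hom.tensorPowerFlatten` an isomorphism `H^{⊗ km} ≅ (H^{⊗ m})^{⊗ k}` (associativity of the tensor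
product of Hodge structures, "given by the usual constructions" on the underlying spaces).
[cite: DeligneHodgeII1971, 1.1.12] [cite: Moonen2017FamiliesMotives, §2.1 (p. 3)] -/
def Hom.tensorPowerUnflatten (H : HodgeStructure V n) (k m : ℕ) :
    Hom ((H.tensorPower (k * m)).cast (by push_cast; ring)) ((H.tensorPower m).tensorPower k) :=
  Hom.ofComapBaseChange (HodgeStructure.tensorPowerUnflatten ℚ V k m) fun p ↦
    comap_tensorPowerUnflatten_tensorPowerFiltration H k m p

/-- The underlying map of `Hom.tensorPowerUnflatten`. [cite: DeligneHodgeII1971, 1.1.12]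
[cite: VoisinHodgeI2002, §11.3.3 Def. 11.39 (PDF p. 236)] -/
@[simp]
theorem Hom.tensorPowerUnflatten_toLinearMap (H : HodgeStructure V n) (k m : ℕ) :
    (Hom.tensorPowerUnflatten H k m).toLinearMap =
      (HodgeStructure.tensorPowerUnflatten ℚ V k m).toLinearMap :=
  rfl

/-- **The flattening morphism of Hodge structures `(H^{⊗ m})^{⊗ k} → H^{⊗ km}`**, underlying map
`(tensorPowerUnflatten ℚ V k m)⁻¹`, `⊗ⱼ ⊗ᵢ v_{ji} ↦ ⊗ v` (inverse of
`Hom.tensorPowerUnflatten`).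
[cite: DeligneHodgeII1971, 1.1.12] [cite: Moonen2017FamiliesMotives, §2.1 (p. 3)] -/
def Hom.tensorPowerFlatten (H : HodgeStructure V n) (k m : ℕ) :
    Hom ((H.tensorPower m).tensorPower k) ((H.tensorPower (k * m)).cast (by push_cast; ring)) :=
  Hom.symmOfComapBaseChange (HodgeStructure.tensorPowerUnflatten ℚ V k m) fun p ↦
    comap_tensorPowerUnflatten_tensorPowerFiltration H k m p

/-- The underlying map of `Hom.tensorPowerFlatten`. [cite: DeligneHodgeII1971, 1.1.12]
[cite: VoisinHodgeI2002, §11.3.3 Def. 11.39 (PDF p. 236)] -/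
@[simp]
theorem Hom.tensorPowerFlatten_toLinearMap (H : HodgeStructure V n) (k m : ℕ) :
    (Hom.tensorPowerFlatten H k m).toLinearMap =
      (HodgeStructure.tensorPowerUnflatten ℚ V k m).symm.toLinearMap :=
  rfl

/-- `flatten ∘ unflatten = id` on `H^{⊗ km}`: the flattening is an isomorphism of Hodge structures.
[cite: DeligneHodgeII1971, 1.1.12] [cite: VoisinHodgeI2002, §11.3.3 Def. 11.39 (PDF p. 236)] -/
theorem Hom.tensorPowerFlatten_tensorPowerUnflatten_apply (H : HodgeStructure V n) (k m : ℕ)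
    (x : ⨂[ℚ]^(k * m) V) :
    (Hom.tensorPowerFlatten H k m).toLinearMap ((Hom.tensorPowerUnflatten H k m).toLinearMap x) =
      x :=
  (HodgeStructure.tensorPowerUnflatten ℚ V k m).symm_apply_apply x

/-- `unflatten ∘ flatten = id` on `(H^{⊗ m})^{⊗ k}`. [cite: DeligneHodgeII1971, 1.1.12]
[cite: VoisinHodgeI2002, §11.3.3 Def. 11.39 (PDF p. 236)] -/
theorem Hom.tensorPowerUnflatten_tensorPowerFlatten_apply (H : HodgeStructure V n) (k m : ℕ)
    (x : ⨂[ℚ]^k (⨂[ℚ]^m V)) :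
    (Hom.tensorPowerUnflatten H k m).toLinearMap ((Hom.tensorPowerFlatten H k m).toLinearMap x) =
      x :=
  (HodgeStructure.tensorPowerUnflatten ℚ V k m).apply_symm_apply x

end FlattenHom

end Hodge

/-! ### Structures of abelian type are closed under tensor powers and exterior powers -/

section AbelianType

open Literature.AlgebraicTopology.SingularHomology

universe u

variable {V : Type u} [AddCommGroup V] [Module ℚ V] {w : ℤ}

/-- **Tensor powers of Hodge structures of abelian type are of abelian type.** If `H` is a direct
summand of `(H¹(A)^{⊗ m})(c)` through morphisms `(j, r)` with `r ∘ j = id`, then `H^{⊗ k}` is a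
direct summand of `(H¹(A)^{⊗ km})(kc)` through `(U⁻¹ ∘ j^{⊗ k}, r^{⊗ k} ∘ U)`, where
`U : H¹(A)^{⊗ km} ≅ ((H¹(A)^{⊗ m})(c))^{⊗ k}` is the flattening (`tensorPowerUnflatten`), an
isomorphism of Hodge structures onto `(H¹(A)^{⊗ km})(kc)` by `tensorPowerFiltration_tateTwist` and
`comap_tensorPowerUnflatten_tensorPowerFiltration`. This is the stability of André's Tannakian
category `ℳ(𝒜b)` ("engendrée par les `𝔥(A)`", §6.1) under tensor powers, on the Hodge side
(Moonen §2.1: `HS_ℚ` is Tannakian, "in particular we have … tensor products"); ONE abelian variety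
suffices. [cite: Andre1996Motifs, §6.1 (p. 30)] [cite: Moonen2017FamiliesMotives, §2.1 (p. 3)]
[cite: DeligneHodgeII1971, 1.1.12 and 2.1.14] -/
theorem IsOfAbelianType.tensorPower [HodgeTensorFacts.{u, u}] {H : HodgeStructure V w}
    (h : H.IsOfAbelianType) (k : ℕ) : (H.tensorPower k).IsOfAbelianType := by
  haveI : HodgeTensorFacts.{0, 0} := hodgeTensorFacts_holds
  obtain ⟨A, hA, M, hM, m, c, hw, j, r, hjr⟩ := h
  set H₁ := M.hodgeStructure hA hM 1 with hH₁
  have hw' : ((k * m : ℕ) : ℤ) - 2 * (k * c) = k * w := by rw [← hw]; push_cast; ring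
  -- the flattening `((H¹^{⊗ m})(c))^{⊗ k} ≅ (H¹^{⊗ km})(kc)` identifies the filtrations
  have hfil : ∀ p, ((((abelianTensor A hA M hM m c).cast hw).tensorPower k).F p).comap
      ((tensorPowerUnflatten ℚ (singularCohomology ℚ ℚ (ComplexPoints A.X) 1) k m)
        |>.toLinearMap.baseChange ℂ) =
      ((abelianTensor A hA M hM (k * m) (k * c)).cast hw').F p := by
    intro p
    show (((H₁.tensorPower m).tateTwist c).tensorPowerFiltration k p).comap _ =
      H₁.tensorPowerFiltration (k * m) (p + k * c)
    rw [tensorPowerFiltration_tateTwist, comap_tensorPowerUnflatten_tensorPowerFiltration]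
  refine ⟨A, hA, M, hM, k * m, k * c, hw',
    (Hom.symmOfComapBaseChange _ hfil).comp (Hom.tensorPowerMap j k),
    (Hom.tensorPowerMap r k).comp (Hom.ofComapBaseChange _ hfil), fun v ↦ ?_⟩
  show (Hom.tensorPowerMap r k).toLinearMap ((tensorPowerUnflatten ℚ _ k m).toLinearMap
    ((tensorPowerUnflatten ℚ _ k m).symm.toLinearMap ((Hom.tensorPowerMap j k).toLinearMap v))) = v
  rw [LinearEquiv.coe_toLinearMap, LinearEquiv.coe_toLinearMap, LinearEquiv.apply_symm_apply,
    Hom.tensorPowerMap_retract j r hjr]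

/-- **Exterior powers of Hodge structures of abelian type are of abelian type**: `⋀ᵏ H` is a
direct summand of `H^{⊗ k}` in `ℚ`-Hodge structures (the tree's
`IsOfAbelianType.exteriorPower_of_tensorPower`, Moonen §3), and `H^{⊗ k}` is of abelian type
(`IsOfAbelianType.tensorPower`). [cite: Andre1996Motifs, §6.1 (p. 30)]
[cite: Moonen2017FamiliesMotives, §2.1 (p. 3) and §3] -/
theorem IsOfAbelianType.exteriorPower [HodgeTensorFacts.{u, u}] {H : HodgeStructure V w}
    (h : H.IsOfAbelianType) (k : ℕ) : (H.exteriorPower k).IsOfAbelianType :=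
  (IsOfAbelianType.tensorPower h k).exteriorPower_of_tensorPower

section Instances

variable [HodgeTensorFacts.{0, 0}]

/-- **Every `Hⁿ(A(ℂ); ℚ)^{⊗ k}` of a complex abelian variety is of abelian type** (`Hⁿ(A)` is,
`isOfAbelianType_hodgeStructure`; then `IsOfAbelianType.tensorPower`). André §6.1: `ℳ(𝒜b)` is
generated by the `𝔥(A)` as a Tannakian category. [cite: Andre1996Motifs, §6.1 (p. 30)] -/
theorem isOfAbelianType_hodgeStructure_tensorPower (A : AbelianVariety ℂ)
    (hA : IsSmoothProjective A.dim A.X) (M : HodgeTheory.HodgeModel A.dim A.X)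
    (hM : M.IsHodgeSymmetric) (n k : ℕ) :
    ((M.hodgeStructure hA hM n).tensorPower k).IsOfAbelianType :=
  IsOfAbelianType.tensorPower (isOfAbelianType_hodgeStructure A hA M hM n) k

/-- **Every `⋀ᵏ Hⁿ(A(ℂ); ℚ)` of a complex abelian variety is of abelian type.**
[cite: Andre1996Motifs, §6.1 (p. 30)] -/
theorem isOfAbelianType_hodgeStructure_exteriorPower (A : AbelianVariety ℂ)
    (hA : IsSmoothProjective A.dim A.X) (M : HodgeTheory.HodgeModel A.dim A.X)
    (hM : M.IsHodgeSymmetric) (n k : ℕ) :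
    ((M.hodgeStructure hA hM n).exteriorPower k).IsOfAbelianType :=
  IsOfAbelianType.exteriorPower (isOfAbelianType_hodgeStructure A hA M hM n) k

/-- Tensor powers `((H¹(A)^{⊗ m})(c))^{⊗ k}` of the generators are of abelian type.
[cite: Andre1996Motifs, §6.1 (p. 30)] -/
theorem isOfAbelianType_abelianTensor_tensorPower (A : AbelianVariety ℂ)
    (hA : IsSmoothProjective A.dim A.X) (M : HodgeTheory.HodgeModel A.dim A.X)
    (hM : M.IsHodgeSymmetric) (m : ℕ) (c : ℤ) (k : ℕ) :
    ((abelianTensor A hA M hM m c).tensorPower k).IsOfAbelianType :=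
  IsOfAbelianType.tensorPower (isOfAbelianType_abelianTensor A hA M hM m c) k

end Instances

end AbelianType

end HodgeStructure

end Literature.AlgebraicGeometry.Motives

end
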